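import Mathlib.LinearAlgebra.FiniteDimensional.Lemmas
import Literature.Computability.AlgebraicComplexity.GKKSDepthFourProofs
import HarnessLib

/-!
# Projected shifted partial derivatives (Kumar–Saraf 2017, §3–§4)

Topic `Literature/Computability/AlgebraicComplexity`; infrastructure for the printed proof of
Kumar–Saraf's `n^{Ω(√n)}` lower bound for homogeneous `ΣΠΣΠ` circuits
(`kumarSaraf2017_imm_homDepthFour`, `HomogeneousDepthFour.lean`), first half: the complexity
measure and its UPPER bound for products of polynomials of bounded bottom support.

* `IsML β` — the exponent vector `β` is multilinear (all exponents `≤ 1`); `chi S` — the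
  indicator exponent vector of a finite set of variables (`x^{chi S} = ∏_{v ∈ S} x_v`).
* `mlProj` — the multilinear projection `σ` of [KS, §3]: the `K`-linear map keeping the
  multilinear monomials of a polynomial and killing the others; `mlProj_monomial_mul_of_not_isML`:
  `σ(x^δ · q) = 0` for non-multilinear `δ`.
* `pspSpan Ls m f` — the space of `(ℳ, m)`-projected shifted partial derivatives
  `⟨σ(x^S · ∂_L f) : L ∈ ℳ, |S| = m⟩` of [KS, Def. 3.1], for a family `Ls : ι → List σ` of
  derivative operators (a monomial `α` of degree `r` = a list of `r` variables) and multilinear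
  shifts of degree exactly `m`; `pspDim Ls m f` — its dimension `Φ_{ℳ,m}(f)`.
* Sub-additivity [KS, Lemma 3.2]: `pspDim_add_le`, `pspDim_smul_le`, `pspDim_sum_smul_le`.
* `SuppLE q t` — every monomial of `q` has support (number of distinct variables) `≤ t`; closure
  under products (`SuppLE.mul`), derivatives (`SuppLE.pderiv`), sums.
* **[KS, Lemma 4.1] (engine)** `iterPderiv_prod_mem_prodSpanSupp`: an order-`r` derivative of
  `∏_{j<l} P_j` with `SuppLE (P_j) s` lies in `⟨(∏_{j ∉ A} P_j) · g : |A| ≤ r, SuppLE g (|A| s)⟩`;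
  **(bound)** `pspDim_prod_le`:
  `Φ_{ℳ,m}(∏_{j<l} P_j) ≤ #{A ⊆ [l] : |A| ≤ r} · ∑_{i=0}^{rs} C(N, m+i)` (`N = |σ|`), and the
  `T`-term form `pspDim_sum_prod_le` for `∑_{i<T} c_i ∏_j Q_{ij}` (sub-additivity). The printed
  statement bounds the inner sum by `rs · C(N, m+rs)` under `m + rs ≤ N/2`; we keep the sum.

Everything here is proved (D-0026: no new named facts). The circuit side (normal form (3.1) of a
homogeneous depth-4 circuit, restrictions) and the lower bound for `IMM` are not in this file.

## References

* M. Kumar, S. Saraf, *On the power of homogeneous depth 4 arithmetic circuits*, SIAM J. Comput.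
  46 (2017) 336–387 (arXiv:1404.1950): §3 (multilinear projections, Def. 3.1, Lemma 3.2),
  §4 (Lemma 4.1).
* N. Kayal, N. Limaye, C. Saha, S. Srinivasan, *An exponential lower bound for homogeneous depth
  four arithmetic formulas*, SIAM J. Comput. 46 (2017) 307–335 (the measure originates here).
-/

noncomputable section

open MvPolynomial

namespace Literature.Computability.AlgebraicComplexity.KumarSaraf

open GKKS

variable {K : Type*} [Field K] {σ : Type*}

/-! ### Multilinear exponent vectors and indicator vectors -/

/-- An exponent vector is **multilinear** if every exponent is at most `1`.
[cite: KumarSaraf2017, §3] -/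
def IsML (β : σ →₀ ℕ) : Prop :=
  ∀ v, β v ≤ 1

/-- Multilinearity is decidable (only the finitely many variables of the support matter).
[folklore] -/
instance IsML.decidable (β : σ →₀ ℕ) : Decidable (IsML β) :=
  decidable_of_iff (∀ v ∈ β.support, β v ≤ 1)
    ⟨fun h v => by
      by_cases hv : v ∈ β.support
      · exact h v hv
      · rw [Finsupp.notMem_support_iff.1 hv]; exact Nat.zero_le _,
     fun h v _ => h v⟩

/-- The indicator exponent vector `∑_{v ∈ S} e_v` of a finite set of variables:
`x^{chi S} = ∏_{v ∈ S} x_v`. [cite: KumarSaraf2017, §3] -/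
def chi (S : Finset σ) : σ →₀ ℕ :=
  ∑ v ∈ S, Finsupp.single v 1

/-- Values of the indicator vector. [folklore] -/
theorem chi_apply [DecidableEq σ] (S : Finset σ) (v : σ) : chi S v = if v ∈ S then 1 else 0 := by
  unfold chi
  rw [Finsupp.finsetSum_apply]
  simp only [Finsupp.single_apply]
  rw [Finset.sum_ite_eq']

/-- Indicator vectors are multilinear. [folklore] -/
theorem isML_chi (S : Finset σ) : IsML (chi S) := by
  classical
  intro v
  rw [chi_apply]
  split_ifs <;> simp

/-- The support of an indicator vector. [folklore] -/
@[simp] theorem support_chi (S : Finset σ) : (chi S).support = S := by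
  classical
  ext v
  rw [Finsupp.mem_support_iff, chi_apply]
  split_ifs with h <;> simp [h]

/-- The degree of an indicator vector. [folklore] -/
@[simp] theorem degree_chi (S : Finset σ) : (chi S).degree = S.card := by
  classical
  rw [Finsupp.degree_apply, support_chi, Finset.card_eq_sum_ones]
  refine Finset.sum_congr rfl fun v hv => ?_
  rw [chi_apply, if_pos hv]

/-- A multilinear exponent vector is the indicator of its support. [folklore] -/
theorem IsML.chi_support [DecidableEq σ] {β : σ →₀ ℕ} (h : IsML β) : chi β.support = β := by
  ext v
  rw [chi_apply]
  split_ifs with hv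
  · have h1 := h v
    have h2 := Finsupp.mem_support_iff.1 hv
    omega
  · exact (Finsupp.notMem_support_iff.1 hv).symm

/-- A multilinear exponent vector has degree equal to the size of its support. [folklore] -/
theorem IsML.degree_eq_card_support {β : σ →₀ ℕ} (h : IsML β) : β.degree = β.support.card := by
  classical
  conv_lhs => rw [← h.chi_support]
  exact degree_chi _

/-- Vectors below a multilinear vector are multilinear. [folklore] -/
theorem IsML.of_le {β δ : σ →₀ ℕ} (h : IsML β) (hle : δ ≤ β) : IsML δ :=
  fun v => (hle v).trans (h v)

/-- The number of variables of a monomial is at most its degree. [folklore] -/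
theorem card_support_le_degree (β : σ →₀ ℕ) : β.support.card ≤ β.degree := by
  rw [Finsupp.degree_apply, Finset.card_eq_sum_ones]
  exact Finset.sum_le_sum fun v hv => Nat.one_le_iff_ne_zero.mpr (Finsupp.mem_support_iff.mp hv)

/-! ### The multilinear projection `σ` -/

section Proj

variable (K)

/-- The **multilinear projection** `σ` of Kumar–Saraf, §3: `σ(x^β) = x^β` if `x^β` is
multilinear and `0` otherwise, extended linearly. [cite: KumarSaraf2017, §3] -/
def mlProj : MvPolynomial σ K →ₗ[K] MvPolynomial σ K where
  toFun f := ∑ β ∈ f.support.filter IsML, monomial β (coeff β f)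
  map_add' f g := by
    classical
    refine MvPolynomial.ext _ _ fun β => ?_
    have key : ∀ q : MvPolynomial σ K,
        coeff β (∑ β' ∈ q.support.filter IsML, monomial β' (coeff β' q)) =
          if IsML β then coeff β q else 0 := by
      intro q
      rw [coeff_sum]
      simp only [coeff_monomial]
      rw [Finset.sum_ite_eq']
      simp only [Finset.mem_filter, mem_support_iff, ne_eq]
      by_cases h1 : IsML β
      · by_cases h2 : coeff β q = 0
        · simp [h1, h2]
        · simp [h1, h2]
      · simp [h1]
    rw [coeff_add, key, key, key, coeff_add]
    split_ifs <;> simp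
  map_smul' c f := by
    classical
    refine MvPolynomial.ext _ _ fun β => ?_
    have key : ∀ q : MvPolynomial σ K,
        coeff β (∑ β' ∈ q.support.filter IsML, monomial β' (coeff β' q)) =
          if IsML β then coeff β q else 0 := by
      intro q
      rw [coeff_sum]
      simp only [coeff_monomial]
      rw [Finset.sum_ite_eq']
      simp only [Finset.mem_filter, mem_support_iff, ne_eq]
      by_cases h1 : IsML β
      · by_cases h2 : coeff β q = 0
        · simp [h1, h2]
        · simp [h1, h2]
      · simp [h1]
    rw [RingHom.id_apply, coeff_smul, key, key, coeff_smul]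
    split_ifs <;> simp

variable {K}

/-- Coefficients of the multilinear projection. [cite: KumarSaraf2017, §3] -/
theorem coeff_mlProj (f : MvPolynomial σ K) (β : σ →₀ ℕ) :
    coeff β (mlProj K f) = if IsML β then coeff β f else 0 := by
  classical
  change coeff β (∑ β' ∈ f.support.filter IsML, monomial β' (coeff β' f)) = _
  rw [coeff_sum]
  simp only [coeff_monomial]
  rw [Finset.sum_ite_eq']
  simp only [Finset.mem_filter, mem_support_iff, ne_eq]
  by_cases h1 : IsML β
  · by_cases h2 : coeff β f = 0
    · simp [h1, h2]
    · simp [h1, h2]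
  · simp [h1]

/-- `σ` on a monomial. [cite: KumarSaraf2017, §3] -/
theorem mlProj_monomial (β : σ →₀ ℕ) (c : K) :
    mlProj K (monomial β c) = if IsML β then monomial β c else 0 := by
  classical
  refine MvPolynomial.ext _ _ fun γ => ?_
  rw [coeff_mlProj]
  by_cases hγ : IsML γ
  · rw [if_pos hγ]
    by_cases hβ : IsML β
    · rw [if_pos hβ]
    · rw [if_neg hβ, coeff_monomial, coeff_zero]
      by_cases h : β = γ
      · exact absurd (h ▸ hγ) hβ
      · rw [if_neg h]
  · rw [if_neg hγ]
    by_cases hβ : IsML β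
    · rw [if_pos hβ, coeff_monomial]
      by_cases h : β = γ
      · exact absurd (h ▸ hβ) hγ
      · rw [if_neg h]
    · rw [if_neg hβ, coeff_zero]

/-- **`σ` kills the multiples of a non-multilinear monomial**: every monomial of `x^δ · q` lies
above `δ`. [cite: KumarSaraf2017, §4 (proof of Lemma 4.1)] -/
theorem mlProj_monomial_mul_of_not_isML {δ : σ →₀ ℕ} (hδ : ¬ IsML δ) (c : K)
    (q : MvPolynomial σ K) : mlProj K (monomial δ c * q) = 0 := by
  classical
  refine MvPolynomial.ext _ _ fun β => ?_
  rw [coeff_mlProj, coeff_zero]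
  split_ifs with hβ
  · rw [coeff_monomial_mul']
    split_ifs with hle
    · exact absurd (hβ.of_le hle) hδ
    · rfl
  · rfl

/-- The support of `σ(f)` consists of the multilinear monomials of `f`. [cite: KumarSaraf2017, §3] -/
theorem mem_support_mlProj {f : MvPolynomial σ K} {β : σ →₀ ℕ} :
    β ∈ (mlProj K f).support ↔ IsML β ∧ β ∈ f.support := by
  rw [mem_support_iff, mem_support_iff, coeff_mlProj]
  split_ifs with h <;> simp [h]

end Proj

/-! ### The measure `Φ_{ℳ,m}`: projected shifted partial derivatives (KS, Def. 3.1) -/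

section Measure

variable {ι : Type*}

/-- The generators `σ(x^S · ∂_L f)` of the space of projected shifted partials, indexed by a
derivative operator `L = Ls i` and a set `S` of exactly `m` variables. [cite: KumarSaraf2017, Def. 3.1] -/
def pspGen (Ls : ι → List σ) (m : ℕ) (f : MvPolynomial σ K)
    (p : ι × {S : Finset σ // S.card = m}) : MvPolynomial σ K :=
  mlProj K (monomial (chi (p.2 : Finset σ)) (1 : K) * iterPderiv (Ls p.1) f)

/-- **The space of `(ℳ, m)`-projected shifted partial derivatives** of `f`
(Kumar–Saraf 2017, Def. 3.1): the `K`-span of `σ(∏_{v ∈ S} x_v · ∂_α f)` over `α ∈ ℳ` (here: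
the derivative operators `∂_{Ls i}`, `i : ι`) and `S ⊆ σ` with `|S| = m`.
[cite: KumarSaraf2017, Def. 3.1] -/
def pspSpan (Ls : ι → List σ) (m : ℕ) (f : MvPolynomial σ K) : Submodule K (MvPolynomial σ K) :=
  Submodule.span K (Set.range (pspGen Ls m f))

/-- **The measure `Φ_{ℳ,m}(f) = dim ⟨∂_ℳ(f)⟩_m`** (Kumar–Saraf 2017, Def. 3.1).
[cite: KumarSaraf2017, Def. 3.1] -/
def pspDim (Ls : ι → List σ) (m : ℕ) (f : MvPolynomial σ K) : ℕ :=
  Module.finrank K (pspSpan Ls m f)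

/-- Each generator lies in the space. [cite: KumarSaraf2017, Def. 3.1] -/
theorem pspGen_mem (Ls : ι → List σ) (m : ℕ) (f : MvPolynomial σ K)
    (p : ι × {S : Finset σ // S.card = m}) : pspGen Ls m f p ∈ pspSpan Ls m f :=
  Submodule.subset_span ⟨p, rfl⟩

/-- The generators are linear in `f`: scalars. [cite: KumarSaraf2017, Lemma 3.2] -/
theorem pspGen_smul (Ls : ι → List σ) (m : ℕ) (c : K) (f : MvPolynomial σ K)
    (p : ι × {S : Finset σ // S.card = m}) :
    pspGen Ls m (c • f) p = c • pspGen Ls m f p := by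
  unfold pspGen
  rw [map_smul, mul_smul_comm, map_smul]

/-- The generators are linear in `f`: sums. [cite: KumarSaraf2017, Lemma 3.2] -/
theorem pspGen_add (Ls : ι → List σ) (m : ℕ) (f g : MvPolynomial σ K)
    (p : ι × {S : Finset σ // S.card = m}) :
    pspGen Ls m (f + g) p = pspGen Ls m f p + pspGen Ls m g p := by
  unfold pspGen
  rw [map_add, mul_add, map_add]

/-- Scaling does not enlarge the space. [cite: KumarSaraf2017, Lemma 3.2] -/
theorem pspSpan_smul_le (Ls : ι → List σ) (m : ℕ) (c : K) (f : MvPolynomial σ K) :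
    pspSpan Ls m (c • f) ≤ pspSpan Ls m f := by
  refine Submodule.span_le.2 ?_
  rintro _ ⟨p, rfl⟩
  rw [pspGen_smul]
  exact Submodule.smul_mem _ c (pspGen_mem Ls m f p)

/-- The space of a sum lies in the sum of the spaces. [cite: KumarSaraf2017, Lemma 3.2] -/
theorem pspSpan_add_le (Ls : ι → List σ) (m : ℕ) (f g : MvPolynomial σ K) :
    pspSpan Ls m (f + g) ≤ pspSpan Ls m f ⊔ pspSpan Ls m g := by
  refine Submodule.span_le.2 ?_
  rintro _ ⟨p, rfl⟩
  rw [pspGen_add]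
  exact Submodule.add_mem_sup (pspGen_mem Ls m f p) (pspGen_mem Ls m g p)

/-- The zero polynomial has the zero space. [cite: KumarSaraf2017, Def. 3.1] -/
theorem pspSpan_zero (Ls : ι → List σ) (m : ℕ) : pspSpan Ls m (0 : MvPolynomial σ K) = ⊥ := by
  rw [pspSpan, Submodule.span_eq_bot]
  rintro _ ⟨p, rfl⟩
  simp [pspGen]

/-- The zero polynomial has measure `0`. [cite: KumarSaraf2017, Def. 3.1] -/
theorem pspDim_zero (Ls : ι → List σ) (m : ℕ) : pspDim Ls m (0 : MvPolynomial σ K) = 0 := by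
  rw [pspDim, pspSpan_zero, finrank_bot]

variable [Fintype ι] [Fintype σ]

/-- The space of projected shifted partials is finite-dimensional (finitely many generators).
[cite: KumarSaraf2017, Def. 3.1] -/
instance pspSpan.moduleFinite (Ls : ι → List σ) (m : ℕ) (f : MvPolynomial σ K) :
    Module.Finite K (pspSpan Ls m f) :=
  Module.Finite.span_of_finite K (Set.finite_range _)

/-- **Sub-additivity, scalars** (Kumar–Saraf 2017, Lemma 3.2): `Φ(c · f) ≤ Φ(f)`.
[cite: KumarSaraf2017, Lemma 3.2] -/
theorem pspDim_smul_le (Ls : ι → List σ) (m : ℕ) (c : K) (f : MvPolynomial σ K) :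
    pspDim Ls m (c • f) ≤ pspDim Ls m f :=
  Submodule.finrank_mono (pspSpan_smul_le Ls m c f)

/-- **Sub-additivity** (Kumar–Saraf 2017, Lemma 3.2): `Φ(f + g) ≤ Φ(f) + Φ(g)`.
[cite: KumarSaraf2017, Lemma 3.2] -/
theorem pspDim_add_le (Ls : ι → List σ) (m : ℕ) (f g : MvPolynomial σ K) :
    pspDim Ls m (f + g) ≤ pspDim Ls m f + pspDim Ls m g :=
  (Submodule.finrank_mono (pspSpan_add_le Ls m f g)).trans
    (Submodule.finrank_add_le_finrank_add_finrank _ _)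

/-- **Sub-additivity over a linear combination** (Kumar–Saraf 2017, Lemma 3.2):
`Φ(∑ c_a f_a) ≤ ∑ Φ(f_a)`. [cite: KumarSaraf2017, Lemma 3.2] -/
theorem pspDim_sum_smul_le {α : Type*} (Ls : ι → List σ) (m : ℕ) (s : Finset α) (c : α → K)
    (f : α → MvPolynomial σ K) :
    pspDim Ls m (∑ a ∈ s, c a • f a) ≤ ∑ a ∈ s, pspDim Ls m (f a) := by
  classical
  induction s using Finset.induction_on with
  | empty => simp only [Finset.sum_empty, pspDim_zero, le_refl]
  | insert a s ha ih =>
    rw [Finset.sum_insert ha, Finset.sum_insert ha]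
    exact (pspDim_add_le Ls m _ _).trans
      (add_le_add ((pspDim_smul_le Ls m _ _)) ih)

end Measure

/-! ### Polynomials of bounded bottom support and the upper bound (KS, Lemma 4.1) -/

section Upper

/-- **Bottom support at most `t`**: every monomial of `q` involves at most `t` distinct
variables (Kumar–Saraf 2017, §3: `ΣΠΣΠ^{{s}}` circuits, "each monomial in each `Q_{ij}` has at
most `s` distinct variables feeding into it"). [cite: KumarSaraf2017, §3] -/
def SuppLE (q : MvPolynomial σ K) (t : ℕ) : Prop :=
  ∀ β ∈ q.support, β.support.card ≤ t

namespace SuppLE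

variable {p q : MvPolynomial σ K} {t t' a b : ℕ}

/-- Monotonicity in the bound. [folklore] -/
theorem mono (h : SuppLE q t) (htt' : t ≤ t') : SuppLE q t' :=
  fun β hβ => (h β hβ).trans htt'

/-- The zero polynomial. [folklore] -/
theorem zero (t : ℕ) : SuppLE (0 : MvPolynomial σ K) t := fun β hβ => by simp at hβ

/-- Monomials. [folklore] -/
theorem monomial (β : σ →₀ ℕ) (c : K) : SuppLE (MvPolynomial.monomial β c) β.support.card := by
  classical
  intro γ hγ
  rw [support_monomial] at hγ
  split_ifs at hγ with h
  · simp at hγ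
  · rw [Finset.mem_singleton] at hγ
    rw [hγ]

/-- Constants have bottom support `0`. [folklore] -/
theorem C (c : K) (t : ℕ) : SuppLE (MvPolynomial.C c : MvPolynomial σ K) t :=
  ((monomial 0 c).mono (by simp)).mono (Nat.zero_le t)

/-- `1` has bottom support `0`. [folklore] -/
theorem one (t : ℕ) : SuppLE (1 : MvPolynomial σ K) t := C 1 t

/-- Variables have bottom support `1`. [folklore] -/
theorem X (v : σ) : SuppLE (MvPolynomial.X v : MvPolynomial σ K) 1 :=
  (monomial (Finsupp.single v 1) 1).mono
    ((Finset.card_le_card Finsupp.support_single_subset).trans (Finset.card_singleton v).le)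

/-- Bounded bottom support from bounded degree: a monomial has at most `deg` variables. [folklore] -/
theorem of_totalDegree_le (h : q.totalDegree ≤ t) : SuppLE q t :=
  fun β hβ => (card_support_le_degree β).trans ((degree_le_totalDegree hβ).trans h)

/-- Scalar multiples. [folklore] -/
theorem smul (c : K) (h : SuppLE q t) : SuppLE (c • q) t :=
  fun β hβ => h β (support_smul hβ)

/-- **Derivatives do not increase bottom support.** [folklore] -/
theorem pderiv (h : SuppLE q t) (v : σ) : SuppLE (MvPolynomial.pderiv v q) t := by
  intro β hβ
  rw [mem_support_iff, coeff_pderiv] at hβ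
  have hβ' : β + Finsupp.single v 1 ∈ q.support := by
    rw [mem_support_iff]
    intro h0
    exact hβ (by rw [h0, zero_mul])
  refine le_trans (Finset.card_le_card fun u hu => ?_) (h _ hβ')
  rw [Finsupp.mem_support_iff] at hu ⊢
  rw [Finsupp.add_apply]
  omega

/-- Iterated derivatives do not increase bottom support. [folklore] -/
theorem iterPderiv (h : SuppLE q t) (L : List σ) : SuppLE (GKKS.iterPderiv L q) t := by
  induction L with
  | nil => simpa using h
  | cons v L ih => rw [iterPderiv_cons]; exact ih.pderiv v

variable [DecidableEq σ]

/-- Sums. [folklore] -/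
theorem add (hp : SuppLE p t) (hq : SuppLE q t) : SuppLE (p + q) t := by
  intro β hβ
  rcases Finset.mem_union.1 (support_add hβ) with h | h
  · exact hp β h
  · exact hq β h

/-- Finite sums. [folklore] -/
theorem sum {α : Type*} (s : Finset α) {f : α → MvPolynomial σ K} (h : ∀ a ∈ s, SuppLE (f a) t) :
    SuppLE (∑ a ∈ s, f a) t := by
  classical
  induction s using Finset.induction_on with
  | empty => simpa using zero t
  | insert a s ha ih =>
    rw [Finset.sum_insert ha]
    exact (h a (Finset.mem_insert_self a s)).add (ih fun b hb => h b (Finset.mem_insert_of_mem hb))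

/-- **Products add bottom supports.** [folklore] -/
theorem mul (hp : SuppLE p a) (hq : SuppLE q b) : SuppLE (p * q) (a + b) := by
  intro β hβ
  obtain ⟨β₁, h₁, β₂, h₂, rfl⟩ := Finset.mem_add.1 (support_mul p q hβ)
  calc (β₁ + β₂).support.card ≤ (β₁.support ∪ β₂.support).card :=
        Finset.card_le_card Finsupp.support_add
    _ ≤ β₁.support.card + β₂.support.card := Finset.card_union_le _ _
    _ ≤ a + b := add_le_add (hp β₁ h₁) (hq β₂ h₂)

/-- Finite products. [folklore] -/
theorem prod {α : Type*} (s : Finset α) {f : α → MvPolynomial σ K} {w : α → ℕ}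
    (h : ∀ a ∈ s, SuppLE (f a) (w a)) : SuppLE (∏ a ∈ s, f a) (∑ a ∈ s, w a) := by
  classical
  induction s using Finset.induction_on with
  | empty => simpa using one 0
  | insert a s ha ih =>
    rw [Finset.prod_insert ha, Finset.sum_insert ha]
    exact (h a (Finset.mem_insert_self a s)).mul (ih fun b hb => h b (Finset.mem_insert_of_mem hb))

end SuppLE

variable [DecidableEq σ]

/-- The span `⟨(∏_{j ∉ A} P_j) · g : |A| ≤ r, SuppLE g (|A|·s)⟩` containing the order-`r`
derivatives of `∏_j P_j` when every `P_j` has bottom support `≤ s` (Kumar–Saraf 2017, proof of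
Lemma 4.1: "each summand is of the form `∂_α(∏_{i ∈ S} P_i) · ∏_{j ∉ S} P_j` where `S` is a
subset of `[l]` of size at most `r`", and `∂_α(∏_{i∈S} P_i)` has monomials of support `≤ rs`).
[cite: KumarSaraf2017, Lemma 4.1] -/
def prodSpanSupp {l : ℕ} (P : Fin l → MvPolynomial σ K) (s r : ℕ) :
    Submodule K (MvPolynomial σ K) :=
  Submodule.span K {p | ∃ (A : Finset (Fin l)) (g : MvPolynomial σ K),
    A.card ≤ r ∧ SuppLE g (A.card * s) ∧ p = (∏ j ∈ Aᶜ, P j) * g}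

/-- **Kumar–Saraf 2017, Lemma 4.1 (engine)**: every order-`r` partial derivative of
`∏_{j<l} P_j`, all `P_j` of bottom support `≤ s`, is a combination of products
`(∏_{j ∉ A} P_j) · g` with `|A| ≤ r` and `g` of bottom support `≤ |A|·s` (iterated Leibniz
rule; derivatives and products of the `P_i`, `i ∈ A`, have monomials of support `≤ |A| s`).
[cite: KumarSaraf2017, Lemma 4.1] -/
theorem iterPderiv_prod_mem_prodSpanSupp {l s : ℕ} (P : Fin l → MvPolynomial σ K)
    (hP : ∀ j, SuppLE (P j) s) (L : List σ) :
    iterPderiv L (∏ j, P j) ∈ prodSpanSupp P s L.length := by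
  induction L with
  | nil =>
    refine Submodule.subset_span ⟨∅, 1, by simp, by simpa using SuppLE.one (K := K) (σ := σ) 0, ?_⟩
    simp
  | cons v L ih =>
    rw [iterPderiv_cons]
    have key : prodSpanSupp P s L.length ≤
        (prodSpanSupp P s (v :: L).length).comap
          (MvPolynomial.pderiv v : Derivation K (MvPolynomial σ K) (MvPolynomial σ K)).toLinearMap := by
      refine Submodule.span_le.mpr ?_
      rintro p ⟨A, g, hA, hg, rfl⟩
      simp only [List.length_cons, SetLike.mem_coe, Submodule.mem_comap, Derivation.coeFn_coe]
      rw [pderiv_mul, pderiv_finset_prod, Finset.sum_mul]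
      refine add_mem (Submodule.sum_mem _ fun j0 hj0 => ?_) ?_
      · have hj0A : j0 ∉ A := Finset.mem_compl.1 hj0
        refine Submodule.subset_span ⟨insert j0 A, MvPolynomial.pderiv v (P j0) * g, ?_, ?_, ?_⟩
        · rw [Finset.card_insert_of_notMem hj0A]; omega
        · rw [Finset.card_insert_of_notMem hj0A]
          have h1 := ((hP j0).pderiv v).mul hg
          refine h1.mono (le_of_eq ?_)
          ring
        · rw [Finset.compl_insert, mul_assoc]
      · exact Submodule.subset_span ⟨A, MvPolynomial.pderiv v g, by omega, hg.pderiv v, rfl⟩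
    exact key ih

variable [Fintype σ]

/-- The spanning family of the proof of Lemma 4.1: `σ(x^T · ∏_{j ∉ A} P_j)` over `|A| ≤ r` and
sets `T` of between `m` and `m + rs` variables (indexed by the excess `i = |T| - m`).
[cite: KumarSaraf2017, Lemma 4.1] -/
def upperFamily {l : ℕ} (P : Fin l → MvPolynomial σ K) (r s m : ℕ)
    (q : {A : Finset (Fin l) // A.card ≤ r} ×
      (Σ i : Fin (r * s + 1), Finset.powersetCard (m + i) (Finset.univ : Finset σ))) :
    MvPolynomial σ K :=
  mlProj K (monomial (chi (q.2.2 : Finset σ)) (1 : K) * ∏ j ∈ (q.1 : Finset (Fin l))ᶜ, P j)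

/-- **Kumar–Saraf 2017, Lemma 4.1 (the span)**: for `P_j` of bottom support `≤ s` and order-`r`
derivative operators, every projected shifted partial `σ(x^S · ∂_L ∏_j P_j)`, `|S| = m`, lies
in the span of the `σ(x^T · ∏_{j ∉ A} P_j)`, `|A| ≤ r`, `m ≤ |T| ≤ m + rs`: shifting
`(∏_{j∉A} P_j) · g` by `x^S` and expanding `g` gives multiples `x^{S+β} · ∏_{j∉A} P_j` with
`|supp β| ≤ rs`; `σ` kills those with `x^{S+β}` non-multilinear, and a multilinear `x^{S+β}` is
`x^T` with `m ≤ |T| ≤ m + rs`. [cite: KumarSaraf2017, Lemma 4.1] -/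
theorem pspSpan_prod_le {ι : Type*} (Ls : ι → List σ) (r : ℕ) (hLs : ∀ i, (Ls i).length = r)
    {l s : ℕ} (P : Fin l → MvPolynomial σ K) (hP : ∀ j, SuppLE (P j) s) (m : ℕ) :
    pspSpan Ls m (∏ j, P j) ≤ Submodule.span K (Set.range (upperFamily P r s m)) := by
  classical
  refine Submodule.span_le.mpr ?_
  rintro _ ⟨⟨i, S, hS⟩, rfl⟩
  simp only [pspGen, SetLike.mem_coe]
  have hmem : iterPderiv (Ls i) (∏ j, P j) ∈ prodSpanSupp P s r :=
    hLs i ▸ iterPderiv_prod_mem_prodSpanSupp P hP (Ls i)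
  have key : prodSpanSupp P s r ≤ (Submodule.span K (Set.range (upperFamily P r s m))).comap
      ((mlProj K).comp (LinearMap.mulLeft K (monomial (chi S) (1 : K)))) := by
    refine Submodule.span_le.mpr ?_
    rintro p ⟨A, g, hA, hg, rfl⟩
    simp only [SetLike.mem_coe, Submodule.mem_comap, LinearMap.comp_apply, LinearMap.mulLeft_apply]
    rw [g.as_sum, Finset.mul_sum, Finset.mul_sum, map_sum]
    refine Submodule.sum_mem _ fun β hβ => ?_
    have hrw : monomial (chi S) (1 : K) * ((∏ j ∈ Aᶜ, P j) * monomial β (coeff β g)) =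
        coeff β g • (monomial (chi S + β) (1 : K) * ∏ j ∈ Aᶜ, P j) := by
      rw [show monomial β (coeff β g) = coeff β g • monomial β (1 : K) by
        rw [smul_monomial, smul_eq_mul, mul_one], mul_smul_comm, mul_smul_comm]
      congr 1
      rw [mul_comm (∏ j ∈ Aᶜ, P j), ← mul_assoc, monomial_mul, mul_one]
    rw [hrw, map_smul]
    refine Submodule.smul_mem _ _ ?_
    by_cases hML : IsML (chi S + β)
    · -- a multilinear shift: `x^{S+β} = x^T`, `T = supp (S + β)`, `m ≤ |T| ≤ m + rs`
      set T : Finset σ := (chi S + β).support with hT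
      have hchi : chi T = chi S + β := hML.chi_support
      have hcard : T.card = m + β.degree := by
        rw [← hML.degree_eq_card_support, map_add, degree_chi, hS]
      have hβs : β.degree ≤ r * s := by
        have h1 : β.support.card ≤ A.card * s := hg β hβ
        have h2 : A.card * s ≤ r * s := Nat.mul_le_mul_right s hA
        -- `β ≤ chi S + β` is multilinear, so `deg β = |supp β|`
        have h3 : β.degree = β.support.card :=
          (hML.of_le (self_le_add_left β (chi S))).degree_eq_card_support
        omega
      have hi : T.card - m < r * s + 1 := by omega
      have hTmem : T ∈ Finset.powersetCard (m + (T.card - m)) (Finset.univ : Finset σ) := by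
        rw [Finset.mem_powersetCard]
        exact ⟨Finset.subset_univ _, by omega⟩
      refine Submodule.subset_span ⟨⟨⟨A, hA⟩, ⟨⟨T.card - m, hi⟩, ⟨T, hTmem⟩⟩⟩, ?_⟩
      simp only [upperFamily, hchi]
    · rw [mlProj_monomial_mul_of_not_isML hML]
      exact Submodule.zero_mem _
  exact key hmem

/-- **Kumar–Saraf 2017, Lemma 4.1 (dimension bound for one product)**: for `P_j`
(`j < l`) of bottom support `≤ s`, order-`r` derivative operators and shift degree `m`,
`Φ_{ℳ,m}(∏_j P_j) ≤ #{A ⊆ [l] : |A| ≤ r} · ∑_{i=0}^{rs} C(N, m+i)`, `N = |σ|`.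
(Print: `≤ C(l + r, r) · rs · C(N, m + rs)` for `m + rs ≤ N/2`; `#{A} ≤ C(l+r, r)` is
`GKKS.numSubsetsLE_le`.) [cite: KumarSaraf2017, Lemma 4.1] -/
theorem pspDim_prod_le {ι : Type*} [Fintype ι] (Ls : ι → List σ) (r : ℕ)
    (hLs : ∀ i, (Ls i).length = r) {l s : ℕ} (P : Fin l → MvPolynomial σ K)
    (hP : ∀ j, SuppLE (P j) s) (m : ℕ) :
    pspDim Ls m (∏ j, P j) ≤
      numSubsetsLE l r * ∑ i ∈ Finset.range (r * s + 1), (Fintype.card σ).choose (m + i) := by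
  classical
  haveI : Module.Finite K (Submodule.span K (Set.range (upperFamily P r s m))) :=
    Module.Finite.span_of_finite K (Set.finite_range _)
  calc pspDim Ls m (∏ j, P j)
      ≤ Module.finrank K (Submodule.span K (Set.range (upperFamily P r s m))) :=
        Submodule.finrank_mono (pspSpan_prod_le Ls r hLs P hP m)
    _ ≤ Fintype.card ({A : Finset (Fin l) // A.card ≤ r} ×
          (Σ i : Fin (r * s + 1), Finset.powersetCard (m + i) (Finset.univ : Finset σ))) :=
        finrank_range_le_card _
    _ = numSubsetsLE l r * ∑ i ∈ Finset.range (r * s + 1), (Fintype.card σ).choose (m + i) := by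
        rw [Fintype.card_prod, Fintype.card_subtype, Fintype.card_sigma, numSubsetsLE]
        congr 1
        rw [Finset.sum_range (fun i => (Fintype.card σ).choose (m + i))]
        refine Finset.sum_congr rfl fun i _ => ?_
        rw [Fintype.card_coe, Finset.card_powersetCard, Finset.card_univ]

/-- **Kumar–Saraf 2017, Lemma 4.1 (the `ΣΠΣΠ^{{s}}` form)**: for
`C = ∑_{i<T} c_i ∏_{j<l} Q_{ij}` with every `Q_{ij}` of bottom support `≤ s` ("`T` is the top
fan-in"), `Φ_{ℳ,m}(C) ≤ T · #{A ⊆ [l] : |A| ≤ r} · ∑_{i=0}^{rs} C(N, m+i)` — sub-additivity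
(Lemma 3.2) over the top sum. [cite: KumarSaraf2017, Lemma 4.1] -/
theorem pspDim_sum_prod_le {ι : Type*} [Fintype ι] (Ls : ι → List σ) (r : ℕ)
    (hLs : ∀ i, (Ls i).length = r) {T l s : ℕ} (c : Fin T → K)
    (Q : Fin T → Fin l → MvPolynomial σ K) (hQ : ∀ i j, SuppLE (Q i j) s) (m : ℕ) :
    pspDim Ls m (∑ i, c i • ∏ j, Q i j) ≤
      T * (numSubsetsLE l r * ∑ i ∈ Finset.range (r * s + 1), (Fintype.card σ).choose (m + i)) := by
  calc pspDim Ls m (∑ i, c i • ∏ j, Q i j) ≤ ∑ i : Fin T, pspDim Ls m (∏ j, Q i j) :=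
        pspDim_sum_smul_le Ls m _ c _
    _ ≤ ∑ _i : Fin T, numSubsetsLE l r *
          ∑ i ∈ Finset.range (r * s + 1), (Fintype.card σ).choose (m + i) :=
        Finset.sum_le_sum fun i _ => pspDim_prod_le Ls r hLs (Q i) (hQ i) m
    _ = _ := by rw [Finset.sum_const, Finset.card_univ, Fintype.card_fin, smul_eq_mul]

end Upper

end Literature.Computability.AlgebraicComplexity.KumarSaraf

end
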